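import Summits.MatrixMultiplication.MatrixMultiplication.Theorems.FarEdgeDescentExpFloor
import HarnessLib

/-!
# Route `FarEdgeDescent` — the defect dial, companion: SEPARATING MODEL WORLDS for the notches
law ⊋ bounded defect ⊋ bare residual, and what the law of record over-asks (no affine head) — all PROVED

decomp-mm ROOT cell (D-0178), lens 2 «structural dichotomy: special vs generic», gen 18; companion of
`FarEdgeDescentDefectDial` (the floor under bounded doubling defect `∃ C, e(m)² ≤ C·(ω−2)·e(2m−1)` — aside
`BoundedDoublingDefect`, stmt-MatrixMultiplication-26556 — and the exact cuts `ω = 2 ⟺ FiniteSaturation ∧ BDD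
⟺ SuperExpContact ∧ BDD`).  Notation: `e(x) := ω(1,x,1) − (x+1)`, `w := ω − 2`, `s := 3 − ω`; `BDD_C` is the
law with defect `C` (`C = 1` is the crux `AnchoredLogConvexity`, stmt-28900).  This file does not import the
dial file (it needs none of its theorems); every statement here is either about an explicit MODEL profile
`E : ℝ → ℝ` (stated as such — nothing is claimed about the true exponents in §4) or, in §5, about the true
exponents under the crux of record.

* §4 **SEPARATING WORLDS (PROVED).**  The notches of the dial are pairwise distinct as profile statements:
  the LINEAR-HEAD world `E(x) = w·max(2−x, e^{1−x}/2)` (convex, non-increasing, `→ 0`, affine of slope `−w`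
  on `[1,3/2]`: `headWorld_affineHead`) obeys `BDD` with `C = 2e²` (`headWorld_bdd`) and VIOLATES the
  anchored law at `m = 3/2` (`headWorld_not_alc`); the STRETCHED world `E(x) = w·exp(−2(x−1) + (√x − 1))`
  has a geometric floor, i.e. the residual-shape statement holds for it (`stretchWorld_floor`), and VIOLATES
  every `BDD_C`: its doubling defect `exp(2√m − √(2m−1) − 1)` is unbounded (`stretchWorld_not_bdd`, witnesses
  `m = n²`).  With gen 17's exponential world (law with equality, `FarEdgeDescentExpFloor.expWorld_law`) and
  Gaussian world (contact without a zero): law ⊋ BDD ⊋ residual and zero ⊋ contact, each inclusion witnessed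
  by a consistent-looking profile — so neither weakening of gen 17/18 is provably idle, and none is provably
  the summit.
* §5 **WHAT THE LAW OF RECORD OVER-ASKS (PROVED).**  `AnchoredLogConvexity` forbids an AFFINE HEAD of the
  true profile: `e(m) = w − t(m−1)` on no interval `[1, 1+2δ]` with `t > 0` (`alc_noAffineHead`) — a GERM
  condition at the square, foreign to the halving mechanism (the floor never reads the profile closer to the
  square than `m − 1 ≈ w/2s`); `BDD` tolerates affine heads (§4) and keeps exactly the doubling-scale content
  the deciding theorems use.  (`noAffineHead_of_mm`: under `ω = 2` the conclusion holds trivially.)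

[cite: LottiRomani1983, §1 (p. 173), §2 (p. 174)] [cite: Coppersmith1982] [cite: HuangPan1998, §8]
-/

set_option linter.dupNamespace false

noncomputable section

namespace Summit.MatrixMultiplication.MatrixMultiplication.Theorems.FarEdgeDescentDefectWorlds

open Literature.Computability.AlgebraicComplexity
open Summit.MatrixMultiplication.MatrixMultiplication.Theses.FarEdgeDescent
open Summit.MatrixMultiplication.MatrixMultiplication.Theorems.FarEdgeDescentChord
open Summit.MatrixMultiplication.MatrixMultiplication.Theorems.FarEdgeDescentExpFloor

/-! ## §4 Separating worlds (model profiles, stated as such) -/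

/-- **Linear-head world: affine head.** `E(x) = w·max(2−x, e^{1−x}/2)` equals `w − w(x−1)` on `[1, 3/2]`
(there `e^{1−x}/2 ≤ 1/2 ≤ 2−x`): an affine head of slope `−w` at the anchor value `w = E(1)`. -/
theorem headWorld_affineHead (w : ℝ) {m : ℝ} (hm : 1 ≤ m) (hm' : m ≤ 3 / 2) :
    w * max (2 - m) (Real.exp (1 - m) / 2) = w - w * (m - 1) := by
  have hexp : Real.exp (1 - m) / 2 ≤ 2 - m := by
    have : Real.exp (1 - m) ≤ 1 := Real.exp_le_one_iff.2 (by linarith)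
    linarith
  rw [max_eq_left hexp]
  ring

/-- **Linear-head world VIOLATES the anchored law** (at `m = 3/2`: `E(3/2)² = w²/4 > w²e^{−1}/2 = w·E(2)`,
since `e > 2`).  So, as profile statements, `BDD` (next theorem) does NOT give the law: the notch is strict. -/
theorem headWorld_not_alc {w : ℝ} (hw : 0 < w) :
    ¬ ∀ m : ℝ, 1 < m → (w * max (2 - m) (Real.exp (1 - m) / 2)) ^ 2 ≤
        w * (w * max (2 - (2 * m - 1)) (Real.exp (1 - (2 * m - 1)) / 2)) := by
  intro h
  have h2 := h (3 / 2) (by norm_num)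
  have e1 : max (2 - (3 / 2 : ℝ)) (Real.exp (1 - 3 / 2) / 2) = 1 / 2 := by
    rw [max_eq_left]
    · norm_num
    · have : Real.exp (1 - 3 / 2 : ℝ) ≤ 1 := Real.exp_le_one_iff.2 (by norm_num)
      linarith
  have e3 : (2 : ℝ) * (3 / 2) - 1 = 2 := by norm_num
  have e2 : max (2 - (2 * (3 / 2 : ℝ) - 1)) (Real.exp (1 - (2 * (3 / 2) - 1)) / 2) =
      Real.exp (-1) / 2 := by
    have e4 : (2 : ℝ) - 2 = 0 := by norm_num
    rw [e3, e4, max_eq_right (by positivity)]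
    norm_num
  rw [e1, e2] at h2
  have hE : (2 : ℝ) < Real.exp 1 := lt_trans (by norm_num) Real.exp_one_gt_d9
  have hinv : Real.exp (-1) * Real.exp 1 = 1 := by rw [← Real.exp_add]; norm_num
  have hpos := Real.exp_pos (-1 : ℝ)
  have he : Real.exp (-1 : ℝ) < 1 / 2 := by nlinarith
  have hw2 := mul_pos (mul_pos hw hw) (sub_pos.2 he)
  nlinarith [h2, hw2]

/-- **Linear-head world OBEYS bounded defect** with `C = 2e²`: for every `m > 1`,
`E(m)² ≤ 2e²·w·E(2m−1)` (`E(m) ≤ w`, `E(2m−1) ≥ w·e^{2−2m}/2`; on `m ≤ 2` use `e²·e^{2−2m} ≥ 1`, on `m > 2`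
the head is gone and `E(m)² = w²e^{2−2m}/4`).  With `headWorld_not_alc`: law ⊋ BDD. -/
theorem headWorld_bdd (w : ℝ) : ∀ m : ℝ, 1 < m →
    (w * max (2 - m) (Real.exp (1 - m) / 2)) ^ 2 ≤
      2 * Real.exp 2 * w * (w * max (2 - (2 * m - 1)) (Real.exp (1 - (2 * m - 1)) / 2)) := by
  intro m hm
  set M := max (2 - m) (Real.exp (1 - m) / 2) with hM
  set M' := max (2 - (2 * m - 1)) (Real.exp (1 - (2 * m - 1)) / 2) with hM'
  have hM0 : 0 ≤ M := le_max_of_le_right (by positivity)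
  have hM1 : M ≤ 1 := max_le (by linarith) (by
      have : Real.exp (1 - m) ≤ 1 := Real.exp_le_one_iff.2 (by linarith)
      linarith)
  have hM'ge : Real.exp (1 - (2 * m - 1)) / 2 ≤ M' := le_max_right _ _
  have hE2 : Real.exp (1 - (2 * m - 1)) = Real.exp (1 - m) ^ 2 := by
    rw [← Real.exp_nat_mul]
    congr 1
    push_cast
    ring
  have key : M ^ 2 ≤ 2 * Real.exp 2 * M' := by
    refine le_trans ?_ (mul_le_mul_of_nonneg_left hM'ge (by positivity))
    rw [hE2]
    rcases le_or_gt m 2 with hm2 | hm2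
    · have h1 : M ^ 2 ≤ 1 := by nlinarith
      have h2 : 1 ≤ Real.exp 2 * Real.exp (1 - m) ^ 2 := by
        rw [← Real.exp_nat_mul, ← Real.exp_add]
        exact Real.one_le_exp (by push_cast; linarith)
      nlinarith [h1, h2]
    · have hMeq : M = Real.exp (1 - m) / 2 := by
        rw [hM]
        exact max_eq_right (by have := Real.exp_pos (1 - m); linarith)
      rw [hMeq]
      have := Real.exp_pos (1 - m)
      have h3 : (1 : ℝ) ≤ Real.exp 2 := Real.one_le_exp (by norm_num)
      nlinarith [sq_nonneg (Real.exp (1 - m)), h3]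
  calc (w * M) ^ 2 = w ^ 2 * M ^ 2 := by ring
    _ ≤ w ^ 2 * (2 * Real.exp 2 * M') := mul_le_mul_of_nonneg_left key (sq_nonneg w)
    _ = 2 * Real.exp 2 * w * (w * M') := by ring

/-- **Stretched world: geometric floor (the residual-shape statement holds).** `E(x) = w·exp(−2(x−1) + (√x−1))`
dominates `w·e^{−2(k−1)}`, hence a geometric sequence: for it the `SuperExpContact`-shape statement fails and
the bare-residual shape `∃ ρ > 0, ∀ k ≥ 2, ρ^k ≤ E(k)` holds. -/
theorem stretchWorld_floor {w : ℝ} (hw : 0 < w) :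
    ∃ ρ : ℝ, 0 < ρ ∧ ∀ k : ℕ, 2 ≤ k →
      ρ ^ k ≤ w * Real.exp (-(2 * ((k : ℝ) - 1)) + (Real.sqrt k - 1)) := by
  refine ⟨Real.exp (-2) * min 1 w, mul_pos (Real.exp_pos _) (lt_min one_pos hw), fun k hk => ?_⟩
  have hgeom := geom_le_expProfile hw (by norm_num : (0 : ℝ) ≤ 2) (k := k) (by omega)
  refine hgeom.trans (mul_le_mul_of_nonneg_left ?_ hw.le)
  rw [Real.exp_le_exp]
  have h1 : 1 ≤ Real.sqrt k := by
    rw [show (1 : ℝ) = Real.sqrt 1 from Real.sqrt_one.symm]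
    exact Real.sqrt_le_sqrt (by exact_mod_cast (by omega : 1 ≤ k))
  linarith

/-- Elementary: `C < exp(2A − B)` gives `C·w·(w·e^B) < (w·e^A)²` (`w > 0`). -/
theorem defect_witness_of_exp {w C A B : ℝ} (hw : 0 < w) (h : C < Real.exp (2 * A - B)) :
    C * w * (w * Real.exp B) < (w * Real.exp A) ^ 2 := by
  have e : Real.exp (2 * A) = Real.exp (2 * A - B) * Real.exp B := by
    rw [← Real.exp_add]; congr 1; ring
  have hkey : C * Real.exp B < Real.exp (2 * A) := by
    rw [e]; exact mul_lt_mul_of_pos_right h (Real.exp_pos B)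
  have e2 : Real.exp A ^ 2 = Real.exp (2 * A) := by rw [← Real.exp_nat_mul]; norm_num
  rw [mul_pow, e2]
  have := mul_lt_mul_of_pos_left hkey (pow_pos hw 2)
  linarith

/-- **Stretched world VIOLATES every bounded-defect law**: for every `C` there is `m > 1` (a square `m = n²`)
with `C·w·E(2m−1) < E(m)²` — the doubling defect `E(m)²/(w·E(2m−1)) = exp(2√m − √(2m−1) − 1)
≥ exp(n/2 − 1)` is unbounded.  With `stretchWorld_floor`: BDD ⊋ residual as profile statements — the
bounded-defect law has content in zero-free worlds with an exponential floor, the residual has none. -/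
theorem stretchWorld_not_bdd {w : ℝ} (hw : 0 < w) (C : ℝ) :
    ∃ m : ℝ, 1 < m ∧
      C * w * (w * Real.exp (-(2 * ((2 * m - 1) - 1)) + (Real.sqrt (2 * m - 1) - 1))) <
        (w * Real.exp (-(2 * (m - 1)) + (Real.sqrt m - 1))) ^ 2 := by
  obtain ⟨n, hn⟩ := exists_nat_gt (max (2 * C + 2) 2)
  have hn2 : (2 : ℝ) < n := (le_max_right _ _).trans_lt hn
  have hnC : 2 * C + 2 < n := (le_max_left _ _).trans_lt hn
  have hn0 : (0 : ℝ) ≤ n := by linarith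
  refine ⟨(n : ℝ) ^ 2, by nlinarith, ?_⟩
  have hsq : Real.sqrt ((n : ℝ) ^ 2) = n := Real.sqrt_sq hn0
  have hsq2 : Real.sqrt (2 * (n : ℝ) ^ 2 - 1) ≤ 3 / 2 * n := by
    rw [show (3 : ℝ) / 2 * n = Real.sqrt ((3 / 2 * n) ^ 2) from (Real.sqrt_sq (by positivity)).symm]
    exact Real.sqrt_le_sqrt (by nlinarith)
  rw [hsq]
  refine defect_witness_of_exp hw ?_
  have hD : (n : ℝ) / 2 - 1 ≤
      2 * (-(2 * ((n : ℝ) ^ 2 - 1)) + ((n : ℝ) - 1)) -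
        (-(2 * ((2 * (n : ℝ) ^ 2 - 1) - 1)) + (Real.sqrt (2 * (n : ℝ) ^ 2 - 1) - 1)) := by
    linarith [hsq2]
  have h1 := Real.add_one_le_exp ((n : ℝ) / 2 - 1)
  have h2 := Real.exp_le_exp.2 hD
  linarith

/-! ## §5 What the law of record over-asks: no affine head -/

/-- **The anchored law forbids an affine head (PROVED).** Under `AnchoredLogConvexity` the excess is affine,
`e(m) = (ω−2) − t(m−1)`, on NO interval `[1, 1+2δ]` with `t > 0`: at `m = 1+δ` the law reads
`(w − tδ)² ≤ w(w − 2tδ)`, i.e. `t²δ² ≤ 0`.  This is a GERM condition at the square — it constrains the profile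
arbitrarily close to `m = 1` — which the halving mechanism never uses (the floors of gen 17 and §1 read the
profile only at `m − 1 ≥ (ω−2)/(2(3−ω))`), and which bounded defect does not impose (`headWorld_affineHead`,
`headWorld_bdd`).  As a statement about the true exponents it is NECESSARY for `ω = 2` (then `t > 0` already
contradicts `e ≥ 0`) and open. -/
theorem alc_noAffineHead (hA : AnchoredLogConvexity) {t δ : ℝ} (ht : 0 < t) (hδ : 0 < δ) :
    ¬ ∀ m : ℝ, 1 ≤ m → m ≤ 1 + 2 * δ →
        omegaRect ℂ 1 m 1 - (m + 1) = (omega ℂ - 2) - t * (m - 1) := by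
  intro h
  have h1 := h (1 + δ) (by linarith) (by linarith)
  have h2 := h (1 + 2 * δ) (by linarith) le_rfl
  have hlaw := hA (1 + δ) (by linarith)
  rw [omegaRect_one_one_one] at hlaw
  have e : (2 : ℝ) * (1 + δ) - 1 = 1 + 2 * δ := by ring
  rw [e] at hlaw
  have e1 : omegaRect ℂ 1 (1 + δ) 1 - (1 + δ + 1) = (omega ℂ - 2) - t * δ := by rw [h1]; ring
  have e2 : omegaRect ℂ 1 (1 + 2 * δ) 1 - 2 * (1 + δ) = (omega ℂ - 2) - t * (2 * δ) := by
    linarith [h2]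
  rw [e1, e2] at hlaw
  have htδ := mul_pos ht hδ
  nlinarith [mul_pos htδ htδ]

/-- Without the law: an affine head with `t > 0` reaching `m = 1 + 2δ` forces `ω > 2` OR contradicts `e ≥ 0`;
precisely, `e(1+2δ) = (ω−2) − 2tδ ≥ 0` gives `ω ≥ 2 + 2tδ` — so "no affine head" is a consequence of `ω = 2`
(tag NEC), proved here for the record. -/
theorem noAffineHead_of_mm (hmm : _root_.MatrixMultiplication) {t δ : ℝ} (ht : 0 < t) (hδ : 0 < δ) :
    ¬ ∀ m : ℝ, 1 ≤ m → m ≤ 1 + 2 * δ →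
        omegaRect ℂ 1 m 1 - (m + 1) = (omega ℂ - 2) - t * (m - 1) :=
  alc_noAffineHead (anchoredLogConvexity_of_mm hmm) ht hδ

end Summit.MatrixMultiplication.MatrixMultiplication.Theorems.FarEdgeDescentDefectWorlds
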